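import Summits.QuantumFields.YangMills.Theorems.BalabanLadderUVSeamRecFloorsC
import Summits.QuantumFields.YangMills.Theorems.LangevinControlUVOSLegsAtWeakCouplingCFblOfFbl6
import Summits.QuantumFields.YangMills.Theorems.BalabanLadderUVSeamRecUnitTransfer
import HarnessLib

/-!
# Crux `UVSeamRec` (stmt-QuantumFields-20043), stub `stub_floors`: the floors stub reduced to NT's femto line

Helper file (`--supports stmt-QuantumFields-20043`) of the lead prover of `stub_floors` (unit `ym-spine-20043-p1`); F-B
plumbing of the split card «floors by unit transfer» (item evidence `LINE-CARD-stub_floors.md`), composing the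
compact-witness floors of `BalabanLadderUVSeamRecFloorsC` with the unit transfer `BalabanLadderUVSeamRecUnitTransfer`:

* `floorsC_of_fcp` — `(∀β, 0 < a β) → a → 0 → FBL → FC2 → FC3 →` compact-witness floors at unit `a`;
* `floorsC_of_femto6` — `IsCompactSimpleLieGroup G → Statement.stub_fcp6 → TwoPointPinned G r a → Skewness G r a →`
  compact-witness floors at unit `a` (through the landed `fbl_of_fbl6`);
* `lowerBounds_uRec_of_femtoEngine` — plane-resolved ceilings at `uRec` (the output of `stub_ceilings`) + the engine
  item `Statement.stub_fcp6` + the femto packages `TwoPointPinned ∧ Skewness` of ONE representation at a unit `a` with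
  `a β / uRec β → c₀ > 0` ⇒ `LowerBounds G r uRec`;
* `stubFloors_of_femtoEngine` — the same in the `SU(2)`/`letI := borel _` shape of the registered skeleton: what remains
  OPEN on the floors side of `UVSeamRec` is exactly {femto packages at an asymptotically two-loop unit (NT's `NTFemto` at
  `SU(2)` + asymptotic scaling of its unit), `Statement.stub_fcp6`, and the ceilings `stub_ceilings`}.
-/

set_option autoImplicit false

noncomputable section

open scoped SchwartzMap
open MeasureTheory Filter Topology Metric
open Literature.MathematicalPhysics.QuantumFieldTheory Literature.MathematicalPhysics.QuantumLattice
open Summit.QuantumFields.YangMills.Cruxes.OSLegsFromFemtoAndGap.DlrCollarTransfer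

namespace Summit.QuantumFields.YangMills.Cruxes.UVSeamRec.FloorsC

section Floors

variable (G : Type) [Group G] [TopologicalSpace G] [IsTopologicalGroup G] [CompactSpace G]
  [MeasurableSpace G] [BorelSpace G] (r : LatticeRep G) (a : ℝ → ℝ)

/-- **Compact-witness floors from the frozen-boundary femto package** `FBL ∧ FC2 ∧ FC3` (the input of the landed
`stub_lower`), for a unit map `a > 0`, `a → 0`. [folklore] -/
theorem floorsC_of_fcp (hapos : ∀ β, 0 < a β) (hlim : Tendsto a atTop (𝓝 0))
    (hFBL : FBL G r a) (hFC2 : FC2 G r a) (hFC3 : FC3 G r a) :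
    (∃ (v : 𝓢(EuclideanSpace ℝ (Fin 4), ℝ)) (ε β₅ Λ₅ : ℝ),
      HasCompactSupport (v : EuclideanSpace ℝ (Fin 4) → ℝ) ∧
      tsupport (v : EuclideanSpace ℝ (Fin 4) → ℝ) ⊆ {y : EuclideanSpace ℝ (Fin 4) | 0 < y 0} ∧ 0 < ε ∧
      ∀ β : ℝ, β₅ ≤ β → ∀ L : ℕ, Λ₅ ≤ a β * L → ε ≤ Q2 G r β L (a β) (thetaTest 4 v) v) ∧
    (∃ (f g h : 𝓢(EuclideanSpace ℝ (Fin 4), ℝ)) (ε β₅ Λ₅ : ℝ),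
      HasCompactSupport (f : EuclideanSpace ℝ (Fin 4) → ℝ) ∧ HasCompactSupport (g : EuclideanSpace ℝ (Fin 4) → ℝ) ∧
      HasCompactSupport (h : EuclideanSpace ℝ (Fin 4) → ℝ) ∧
      Disjoint (tsupport (f : EuclideanSpace ℝ (Fin 4) → ℝ)) (tsupport (g : EuclideanSpace ℝ (Fin 4) → ℝ)) ∧
      Disjoint (tsupport (g : EuclideanSpace ℝ (Fin 4) → ℝ)) (tsupport (h : EuclideanSpace ℝ (Fin 4) → ℝ)) ∧
      Disjoint (tsupport (f : EuclideanSpace ℝ (Fin 4) → ℝ)) (tsupport (h : EuclideanSpace ℝ (Fin 4) → ℝ)) ∧ 0 < ε ∧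
      ∀ β : ℝ, β₅ ≤ β → ∀ L : ℕ, Λ₅ ≤ a β * L → ε ≤ |Q3 G r β L (a β) f g h|) :=
  ⟨lowerBoundsC_twoPoint G r a hapos hlim hFBL hFC2, lowerBoundsC_threePoint G r a hapos hlim hFBL hFC2 hFC3⟩

/-- **Compact-witness floors from the femto packages and the engine item** `Statement.stub_fcp6`
(`TwoPointPinned → Skewness → FBL6 ∧ FC2 ∧ FC3`, through the landed `fbl_of_fbl6`). [folklore] -/
theorem floorsC_of_femto6 (hG : IsCompactSimpleLieGroup G) (hfcp : Statement.stub_fcp6)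
    (hTP : TwoPointPinned G r a) (hSk : Skewness G r a) :
    (∃ (v : 𝓢(EuclideanSpace ℝ (Fin 4), ℝ)) (ε β₅ Λ₅ : ℝ),
      HasCompactSupport (v : EuclideanSpace ℝ (Fin 4) → ℝ) ∧
      tsupport (v : EuclideanSpace ℝ (Fin 4) → ℝ) ⊆ {y : EuclideanSpace ℝ (Fin 4) | 0 < y 0} ∧ 0 < ε ∧
      ∀ β : ℝ, β₅ ≤ β → ∀ L : ℕ, Λ₅ ≤ a β * L → ε ≤ Q2 G r β L (a β) (thetaTest 4 v) v) ∧
    (∃ (f g h : 𝓢(EuclideanSpace ℝ (Fin 4), ℝ)) (ε β₅ Λ₅ : ℝ),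
      HasCompactSupport (f : EuclideanSpace ℝ (Fin 4) → ℝ) ∧ HasCompactSupport (g : EuclideanSpace ℝ (Fin 4) → ℝ) ∧
      HasCompactSupport (h : EuclideanSpace ℝ (Fin 4) → ℝ) ∧
      Disjoint (tsupport (f : EuclideanSpace ℝ (Fin 4) → ℝ)) (tsupport (g : EuclideanSpace ℝ (Fin 4) → ℝ)) ∧
      Disjoint (tsupport (g : EuclideanSpace ℝ (Fin 4) → ℝ)) (tsupport (h : EuclideanSpace ℝ (Fin 4) → ℝ)) ∧
      Disjoint (tsupport (f : EuclideanSpace ℝ (Fin 4) → ℝ)) (tsupport (h : EuclideanSpace ℝ (Fin 4) → ℝ)) ∧ 0 < ε ∧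
      ∀ β : ℝ, β₅ ≤ β → ∀ L : ℕ, Λ₅ ≤ a β * L → ε ≤ |Q3 G r β L (a β) f g h|) := by
  obtain ⟨hFBL6, hFC2, hFC3⟩ := hfcp G hG r a hTP hSk
  obtain ⟨Γ, β₀, ℓ₀, c, C, -, -, hpos, hlim, -⟩ := hTP
  exact floorsC_of_fcp G r a hpos hlim (fbl_of_fbl6 r a hFBL6) hFC2 hFC3

/-- **The floors stub reduced to NT's line.**  Plane-resolved ceilings at `uRec`, the engine item
`Statement.stub_fcp6` and the femto packages `TwoPointPinned ∧ Skewness` of `r` at a unit `a` with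
`a β / uRec β → c₀ > 0` give the floors at the unit of record: `LowerBounds G r uRec`. [folklore] -/
theorem lowerBounds_uRec_of_femtoEngine (hG : IsCompactSimpleLieGroup G) (hfcp : Statement.stub_fcp6) {c₀ : ℝ}
    (hc₀ : 0 < c₀) (hau : Tendsto (fun β => a β / Transport.uRec β) atTop (𝓝 c₀))
    (hTP : TwoPointPinned G r a) (hSk : Skewness G r a) (hMB : MomentBounds6 G r Transport.uRec) :
    LowerBounds G r Transport.uRec := by
  have hpos : ∀ β, 0 < a β := by
    obtain ⟨Γ, β₀, ℓ₀, c, C, -, -, hpos, -, -⟩ := hTP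
    exact hpos
  obtain ⟨h2, h3⟩ := floorsC_of_femto6 G r a hG hfcp hTP hSk
  exact UnitTransfer.lowerBounds_uRec_of_engine r hc₀ hpos hau hMB h2 h3

end Floors

/-- **The floors stub of the `UVSeamRec` skeleton reduced to NT's femto line** (skeleton shape, `SU(2)` Borel):
the conclusion of the registered `stub_ceilings` + `Statement.stub_fcp6` + ONE lattice representation of `SU(2)` with the
femto packages at a unit asymptotic to `c₀ · uRec` ⇒ the conclusion of the registered `stub_floors` verbatim.
(`IsCompactSimpleLieGroup SU(2)` is carried as a hypothesis; in `UVSeamRec_of` it is the binder `hG` transported along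
`e : G ≃ₜ* SU(2)`, or the tree's `isCompactSimpleLieGroup_specialUnitaryGroup`.) [folklore] -/
theorem stubFloors_of_femtoEngine (hSU2 : IsCompactSimpleLieGroup (Matrix.specialUnitaryGroup (Fin 2) ℂ))
    (hfcp : Statement.stub_fcp6)
    (hceil : letI : MeasurableSpace (Matrix.specialUnitaryGroup (Fin 2) ℂ) := borel _
      haveI : BorelSpace (Matrix.specialUnitaryGroup (Fin 2) ℂ) := ⟨rfl⟩
      ∀ r : LatticeRep (Matrix.specialUnitaryGroup (Fin 2) ℂ),
        MomentBounds6 (Matrix.specialUnitaryGroup (Fin 2) ℂ) r Transport.uRec)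
    (heng : letI : MeasurableSpace (Matrix.specialUnitaryGroup (Fin 2) ℂ) := borel _
      haveI : BorelSpace (Matrix.specialUnitaryGroup (Fin 2) ℂ) := ⟨rfl⟩
      ∃ (r : LatticeRep (Matrix.specialUnitaryGroup (Fin 2) ℂ)) (a : ℝ → ℝ) (c₀ : ℝ), 0 < c₀ ∧
        Tendsto (fun β => a β / Transport.uRec β) atTop (𝓝 c₀) ∧
        TwoPointPinned (Matrix.specialUnitaryGroup (Fin 2) ℂ) r a ∧ Skewness (Matrix.specialUnitaryGroup (Fin 2) ℂ) r a) :
    letI : MeasurableSpace (Matrix.specialUnitaryGroup (Fin 2) ℂ) := borel _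
    haveI : BorelSpace (Matrix.specialUnitaryGroup (Fin 2) ℂ) := ⟨rfl⟩
    ∃ r : LatticeRep (Matrix.specialUnitaryGroup (Fin 2) ℂ),
      LowerBounds (Matrix.specialUnitaryGroup (Fin 2) ℂ) r Transport.uRec := by
  letI : MeasurableSpace (Matrix.specialUnitaryGroup (Fin 2) ℂ) := borel _
  haveI : BorelSpace (Matrix.specialUnitaryGroup (Fin 2) ℂ) := ⟨rfl⟩
  obtain ⟨r, a, c₀, hc₀, hau, hTP, hSk⟩ := heng
  exact ⟨r, lowerBounds_uRec_of_femtoEngine _ r a hSU2 hfcp hc₀ hau hTP hSk (hceil r)⟩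

end Summit.QuantumFields.YangMills.Cruxes.UVSeamRec.FloorsC

end
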